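import Mathlib.RingTheory.Valuation.ValuationRing
import Mathlib.RingTheory.Localization.AtPrime.Basic
import Mathlib.RingTheory.LocalRing.ResidueField.Basic
import Mathlib.RingTheory.Ideal.GoingUp
import Mathlib.RingTheory.IntegralClosure.IntegrallyClosed
import Mathlib.Algebra.CharP.Basic
import HarnessLib

/-!
# A local ring of integers above a valuation ring inside a field extension
# (`S = (integral closure)_𝔓`, `S ∩ K = V`; proofs only)

Topic `RingTheory/Valuation` (proofs only; no definitions, no named facts). Let `V` be a
valuation ring with fraction field `K` and `F ⊇ K` a field extension (e.g. an algebraic closure).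
Let `S̄` be the integral closure of `V` in `F`, `𝔓 ⊂ S̄` a maximal ideal above the maximal ideal
`𝔪` of `V` (it exists: lying over), and `S = S̄_𝔓` its local ring, mapped into `F` by
`f : S → F` (fractions `a/b`, `b ∉ 𝔓`). This file proves that `(S, f)` is a "ring of integers of
`F` above `V`" in the following elementary sense (`exists_localIntegralPackage`):

* `f` is injective and extends `V → F`; every element of `F` integral over `V` is in the image;
* **`f(S) ∩ K = V`**: an element of `K` which lies in `f(S)` lies in `V` — because `V` is a
  valuation ring: if `x ∉ V` then `x⁻¹ ∈ 𝔪`, so `x⁻¹ ∈ 𝔓S` could not be inverted in the local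
  ring `S`;
* **`𝔪_S ∩ V = 𝔪`**: `c ∈ V` reduces to `0` in the residue field of `S` iff `c ∈ 𝔪`; hence the
  residue field of `S` has characteristic `p` when `p ∈ 𝔪` (`charP_residueField_localization_integralClosure`);
* units: a polynomial over `V` with unit constant term and all other coefficients in `𝔪` takes
  unit values on `S` (`isUnit_eval_map_of_coeff_mem`).

This is the ring package `(F, K₀ = K, 𝒪 = V, S, k = residue field of S)` — with the hypotheses
`hOK`, `hker`, `hfi`, and the units `φ_ψ(rᵢ) ∈ Sˣ` — under which the tree's
`VeluKernelReductionProofs` (Blakestad–Grant 2023, Prop. 7) runs, for `V` a (discrete) valuation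
ring such as the local ring `R̂_(p)` of Blakestad–Grant's `R̂` at `(p)`
(`Literature.RingTheory.DiscreteValuationRing.isDiscreteValuationRing_of_forall_exists_not_pow_dvd`),
whose outputs then descend to `R̂` by `pᵏR̂_(p) ∩ R̂ = pᵏR̂`.

## Sources

* N. Bourbaki, *Commutative Algebra*, Ch. VI §1 no. 2 (valuation rings: `x ∈ V` or `x⁻¹ ∈ V`),
  §8 no. 6 (integral closure of a valuation ring in an extension; the local rings at the maximal
  ideals above `𝔪`); Ch. V §2 no. 1 (lying over). [Bourbaki1989CommAlg]
* H. Matsumura, *Commutative Ring Theory*, Thm. 9.3 (lying over), Thm. 10.2–10.4 (valuation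
  rings dominate). [Matsumura1986]

Pure proof file: the local ring `S` is Mathlib's `Localization.AtPrime 𝔓`; the map `f` is
`IsLocalization.lift`, produced existentially.
-/

noncomputable section

namespace Literature.RingTheory.Valuation

open IsLocalRing

section Injective

variable (V : Type*) [CommRing V] [IsDomain V]
variable (K : Type*) [Field K] [Algebra V K] [IsFractionRing V K]
variable (F : Type*) [Field F] [Algebra V F] [Algebra K F] [IsScalarTower V K F]

include K in
omit [IsDomain V] in
/-- `V → F` is injective (through the fraction field `K`). [folklore] -/
theorem algebraMap_injective_of_isFractionRing : Function.Injective (algebraMap V F) := by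
  rw [IsScalarTower.algebraMap_eq V K F, RingHom.coe_comp]
  exact (algebraMap K F).injective.comp (IsFractionRing.injective V K)

end Injective

section LyingOver

variable (V : Type*) [CommRing V] [IsLocalRing V]
variable (F : Type*) [Field F] [Algebra V F]

/-- **A maximal ideal of the integral closure above `𝔪_V`** exists as soon as `V → F` is
injective (lying over). [Bourbaki AC V §2 no. 1; Matsumura Thm. 9.3] [folklore] -/
theorem exists_isMaximal_comap_eq (hinj : Function.Injective (algebraMap V F)) :
    ∃ 𝔓 : Ideal (integralClosure V F), 𝔓.IsMaximal ∧
      𝔓.comap (algebraMap V (integralClosure V F)) = maximalIdeal V := by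
  refine Ideal.exists_ideal_over_maximal_of_isIntegral (maximalIdeal V) fun c hc => ?_
  rw [RingHom.mem_ker] at hc
  have : algebraMap V F c = 0 := by
    rw [IsScalarTower.algebraMap_apply V (integralClosure V F) F, hc, map_zero]
  rw [hinj (this.trans (map_zero _).symm)]
  exact Ideal.zero_mem _

end LyingOver

section Package

variable {V : Type*} [CommRing V] [IsDomain V] [ValuationRing V]
variable {K : Type*} [Field K] [Algebra V K] [IsFractionRing V K]
variable {F : Type*} [Field F] [Algebra V F] [Algebra K F] [IsScalarTower V K F]
variable (𝔓 : Ideal (integralClosure V F)) [𝔓.IsMaximal]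
  (h𝔓 : 𝔓.comap (algebraMap V (integralClosure V F)) = maximalIdeal V)

omit [ValuationRing V] [IsDomain V] in
/-- The elements of `S̄ ∖ 𝔓` are invertible in `F`. [folklore] -/
theorem isUnit_val_of_mem_primeCompl (y : 𝔓.primeCompl) :
    IsUnit ((integralClosure V F).val.toRingHom (y : integralClosure V F)) := by
  refine isUnit_iff_ne_zero.mpr fun h => y.2 ?_
  have : (y : integralClosure V F) = 0 := Subtype.ext h
  rw [this]
  exact 𝔓.zero_mem

include h𝔓 in
/-- `V → S̄ → S̄_𝔓` lands in the maximal ideal exactly on `𝔪_V`. [folklore] -/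
theorem algebraMap_mem_maximalIdeal_iff (c : V) :
    algebraMap (integralClosure V F) (Localization.AtPrime 𝔓) (algebraMap V (integralClosure V F) c) ∈
      maximalIdeal (Localization.AtPrime 𝔓) ↔ c ∈ maximalIdeal V := by
  rw [IsLocalization.AtPrime.to_map_mem_maximal_iff (Localization.AtPrime 𝔓) 𝔓, ← Ideal.mem_comap, h𝔓]

include h𝔓 in
/-- **The local integral package above a valuation ring.** With `S̄` the integral closure of the
valuation ring `V` (fraction field `K`) in the extension field `F`, and `𝔓 ⊂ S̄` a maximal ideal
above `𝔪_V`, the local ring `S = S̄_𝔓` admits an injective ring map `f : S → F` extending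
`V → F` and the inclusion of `S̄`, such that: every `V`-integral element of `F` is in `f(S)`;
`f(S) ∩ K = V` (`hOK`); and `c ∈ V` reduces to `0` in the residue field of `S` iff `c ∈ 𝔪_V`
(`hker`). [Bourbaki AC VI §1 no. 2, §8 no. 6] [cite: Bourbaki1989CommAlg, VI §8 no. 6] -/
theorem exists_localIntegralPackage :
    ∃ f : Localization.AtPrime 𝔓 →+* F,
      Function.Injective f ∧
      f.comp ((algebraMap (integralClosure V F) (Localization.AtPrime 𝔓)).comp
        (algebraMap V (integralClosure V F))) = algebraMap V F ∧
      (∀ y : integralClosure V F,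
        f (algebraMap (integralClosure V F) (Localization.AtPrime 𝔓) y) = y) ∧
      (∀ y : F, IsIntegral V y → ∃ s, f s = y) ∧
      (∀ x : K, algebraMap K F x ∈ Set.range f → ∃ v : V, algebraMap V K v = x) ∧
      (∀ c : V, residue (Localization.AtPrime 𝔓)
          (algebraMap (integralClosure V F) (Localization.AtPrime 𝔓) (algebraMap V (integralClosure V F) c)) = 0 ↔
        c ∈ maximalIdeal V) := by
  set S := Localization.AtPrime 𝔓 with hSdef
  set g : integralClosure V F →+* F := (integralClosure V F).val.toRingHom with hgdef
  have hg : ∀ y : 𝔓.primeCompl, IsUnit (g y) := isUnit_val_of_mem_primeCompl 𝔓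
  set f : S →+* F := IsLocalization.lift (M := 𝔓.primeCompl) hg with hfdef
  have hginj : Function.Injective g := Subtype.val_injective
  have hfalg : ∀ y : integralClosure V F, f (algebraMap _ S y) = y := fun y => IsLocalization.lift_eq hg y
  -- injectivity
  have hfinj : Function.Injective f := by
    refine (injective_iff_map_eq_zero f).mpr fun z hz => ?_
    obtain ⟨⟨a, b⟩, rfl⟩ := IsLocalization.mk'_surjective 𝔓.primeCompl z
    dsimp only at hz ⊢
    have ha : g a = 0 := by
      have := (IsLocalization.lift_mk'_spec (M := 𝔓.primeCompl) hg a 0 b).mp hz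
      rwa [mul_zero] at this
    have ha0 : a = 0 := hginj (ha.trans (map_zero g).symm)
    rw [ha0, IsLocalization.mk'_zero]
  refine ⟨f, hfinj, ?_, hfalg, ?_, ?_, ?_⟩
  · -- `f` extends `V → F`
    ext c
    rw [RingHom.comp_apply, RingHom.comp_apply, hfalg, IsScalarTower.algebraMap_apply V (integralClosure V F) F]
    rfl
  · -- integral elements
    intro y hy
    exact ⟨algebraMap (integralClosure V F) S ⟨y, hy⟩, hfalg _⟩
  · -- `f(S) ∩ K = V`
    rintro x ⟨s, hs⟩
    rcases ValuationRing.isInteger_or_isInteger V x with ⟨v, hv⟩ | ⟨v, hv⟩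
    · exact ⟨v, hv⟩
    · by_cases hx : x = 0
      · exact ⟨0, by rw [hx, map_zero]⟩
      -- `x⁻¹ = v`; `v` must be a unit of `V`, since `s·ι(v) = 1` in `S`
      have hsv : s * algebraMap _ S (algebraMap V (integralClosure V F) v) = 1 := by
        apply hfinj
        rw [map_mul, map_one, hfalg, hs]
        change algebraMap K F x * algebraMap (integralClosure V F) F (algebraMap V _ v) = 1
        rw [← IsScalarTower.algebraMap_apply, IsScalarTower.algebraMap_apply V K F, hv, ← map_mul,
          mul_inv_cancel₀ hx, map_one]
      have hvu : IsUnit v := by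
        by_contra hvn
        have hvm : v ∈ maximalIdeal V := (mem_maximalIdeal v).mpr hvn
        have hSm := (algebraMap_mem_maximalIdeal_iff 𝔓 h𝔓 v).mpr hvm
        exact (mem_maximalIdeal _).mp hSm (IsUnit.of_mul_eq_one_right _ hsv)
      refine ⟨↑hvu.unit⁻¹, ?_⟩
      rw [← inv_inv x]
      change algebraMap V K ↑hvu.unit⁻¹ = x⁻¹⁻¹
      rw [← hv]
      change algebraMap V K ↑hvu.unit⁻¹ = (algebraMap V K v)⁻¹
      refine eq_inv_of_mul_eq_one_left ?_
      rw [← map_mul]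
      nth_rewrite 2 [← hvu.unit_spec]
      rw [Units.inv_mul, map_one]
  · -- `𝔪_S ∩ V = 𝔪_V`
    intro c
    rw [residue_eq_zero_iff, algebraMap_mem_maximalIdeal_iff 𝔓 h𝔓]

include h𝔓 in
/-- **The residue field of `S = S̄_𝔓` has characteristic `p`** when `p ∈ 𝔪_V`. [folklore] -/
theorem charP_residueField_localization_integralClosure {p : ℕ} (hp : p.Prime) (hpm : (p : V) ∈ maximalIdeal V) :
    CharP (ResidueField (Localization.AtPrime 𝔓)) p := by
  refine (CharP.charP_iff_prime_eq_zero hp).mpr ?_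
  have h := (algebraMap_mem_maximalIdeal_iff 𝔓 h𝔓 (p : V)).mpr hpm
  rw [map_natCast, map_natCast] at h
  rw [← map_natCast (residue (Localization.AtPrime 𝔓)), residue_eq_zero_iff]
  exact h

end Package

section Units

variable {V : Type*} [CommRing V] [IsLocalRing V]

/-- **Unit values.** If `φ ∈ V[X]` has unit constant coefficient and all other coefficients in
`𝔪_V`, then `φ(s)` is a unit of any local ring `S` under a ring map `ι : V → S` with
`ι(𝔪_V) ⊆ 𝔪_S` — in particular of `S = S̄_𝔓` above (`isUnit_eval_map_localization`).
[folklore] -/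
theorem isUnit_eval_map_of_coeff_mem {S : Type*} [CommRing S] [IsLocalRing S] (ι : V →+* S)
    (hι : ∀ c ∈ maximalIdeal V, ι c ∈ maximalIdeal S) {φ : Polynomial V}
    (h0 : IsUnit (φ.coeff 0)) (hi : ∀ i, 1 ≤ i → φ.coeff i ∈ maximalIdeal V) (s : S) :
    IsUnit ((φ.map ι).eval s) := by
  -- `φ(s) - ι(φ₀) ∈ 𝔪_S`
  have hmem : (φ.map ι).eval s - ι (φ.coeff 0) ∈ maximalIdeal S := by
    rw [Polynomial.eval_eq_sum_range, Finset.sum_range_succ', pow_zero, mul_one, Polynomial.coeff_map,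
      add_sub_cancel_right]
    refine sum_mem fun i _ => Ideal.mul_mem_right _ _ ?_
    rw [Polynomial.coeff_map]
    exact hι _ (hi (i + 1) (Nat.succ_pos i))
  have hu : IsUnit (ι (φ.coeff 0)) := h0.map ι
  by_contra hnu
  have h1 : (φ.map ι).eval s ∈ maximalIdeal S := (mem_maximalIdeal _).mpr hnu
  have h2 : ι (φ.coeff 0) ∈ maximalIdeal S := by
    have := sub_mem h1 hmem
    rwa [sub_sub_cancel] at this
  exact (mem_maximalIdeal _).mp h2 hu

variable {F : Type*} [Field F] [Algebra V F]
variable (𝔓 : Ideal (integralClosure V F)) [𝔓.IsMaximal]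
  (h𝔓 : 𝔓.comap (algebraMap V (integralClosure V F)) = maximalIdeal V)

include h𝔓 in
/-- In particular for `S = S̄_𝔓`: `φ(s) ∈ Sˣ` for every `s ∈ S` when `φ₀ ∈ Vˣ` and `φᵢ ∈ 𝔪_V`
(`i ≥ 1`) — the units `φ_ψ(rᵢ)` of Blakestad–Grant's proof of Prop. 7 ("`p²N'(x - rᵢ) = φ_ψ(rᵢ)²`
… is invertible in `R̂[rᵢ]`"). [folklore] -/
theorem isUnit_eval_map_localization {φ : Polynomial V} (h0 : IsUnit (φ.coeff 0))
    (hi : ∀ i, 1 ≤ i → φ.coeff i ∈ maximalIdeal V) (s : Localization.AtPrime 𝔓) :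
    IsUnit ((φ.map ((algebraMap (integralClosure V F) (Localization.AtPrime 𝔓)).comp
      (algebraMap V (integralClosure V F)))).eval s) := by
  refine isUnit_eval_map_of_coeff_mem _ (fun c hc => ?_) h0 hi s
  rw [RingHom.comp_apply, IsLocalization.AtPrime.to_map_mem_maximal_iff (Localization.AtPrime 𝔓) 𝔓,
    ← Ideal.mem_comap, h𝔓]
  exact hc

end Units

end Literature.RingTheory.Valuation
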